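import Mathlib
import Summits.CriticalPhenomena.CardyFormulaZ2.Theses.CardyWhiteToColoured
import Literature.Probability.Percolation.SmoothedWhiteNoise
import Summits.CriticalPhenomena.CardyFormulaZ2.Theorems.CardyWhiteToColouredDriftBoundStubWhiteWindow
import Summits.CriticalPhenomena.CardyFormulaZ2.Theorems.CardyWhiteToColouredDriftBoundUniformRSW
import Summits.CriticalPhenomena.CardyFormulaZ2.Theorems.CardyWhiteToColouredDriftBoundWindowHardness
import Summits.CriticalPhenomena.CardyFormulaZ2.Theorems.CardyWhiteToColouredDriftBoundPlackettDefs
import Summits.CriticalPhenomena.CardyFormulaZ2.Theorems.CardyWhiteToColouredDriftBoundPlackettStein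
import Summits.CriticalPhenomena.CardyFormulaZ2.Theorems.CardyWhiteToColouredDriftBoundPlackettEnvelope
import Summits.CriticalPhenomena.CardyFormulaZ2.Theorems.CardyWhiteToColouredDriftBoundPlackettDeriv
import Summits.CriticalPhenomena.CardyFormulaZ2.Theorems.CardyWhiteToColouredDriftBoundPlackettIBP
import Summits.CriticalPhenomena.CardyFormulaZ2.Theorems.CardyWhiteToColouredDriftBoundPlackettWeights
import Summits.CriticalPhenomena.CardyFormulaZ2.Theorems.CardyWhiteToColouredDriftBoundPlackettVar
import Summits.CriticalPhenomena.CardyFormulaZ2.Theorems.CardyWhiteToColouredDriftBoundPlackettRegIndicator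
import Summits.CriticalPhenomena.CardyFormulaZ2.Theorems.CardyWhiteToColouredDriftBoundPlackettNormWeight
import Summits.CriticalPhenomena.CardyFormulaZ2.Theorems.CardyWhiteToColouredDriftBoundStubLocality
import Summits.CriticalPhenomena.CardyFormulaZ2.Theorems.CardyWhiteToColouredDriftBoundStubRegLimit
import Summits.CriticalPhenomena.CardyFormulaZ2.Theorems.CardyWhiteToColouredDriftBoundStubDriftIdentity
import Summits.CriticalPhenomena.CardyFormulaZ2.Theorems.CardyWhiteToColouredDriftBoundStubDriftContinuous

/-!
# Skeleton v4 for crux `DriftBound` — line `registered`/`birth`, route `CardyWhiteToColoured` of `CardyFormulaZ2`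

Crux item `stmt-CriticalPhenomena-4596`, decl
`Summit.CriticalPhenomena.CardyFormulaZ2.Theses.CardyWhiteToColoured.DriftBound`:
for every conformal rectangle `R`, `lim_{ℓ→0} limsup_{δ→0⁺} |P_δ(R) − P^latt_{ℓ,δ}(R)| = 0`, where
`P_δ(R) = bondDomainCrossingProb R δ` (bond-`ℤ²`, `p = 1/2`) and
`P(s) := P^latt_{s,δ}(R) = smoothedCrossingProb s δ R.carrier (R.arc 0) (R.arc 2)` (crossing of `R`
at mesh `δ` by the positive set of the i.i.d. `N(0,1)` edge-midpoint noise smoothed by the Gaussian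
kernel of width `s`). Only `σ = s/δ` matters for the signs: `P(s)` is the crossing probability of
`R_δ` for the lattice model `sign(k_σ ⋆ ξ)`, `σ = s/δ` (`smoothedCrossingProb_eq_signConfigLaw_div`).

## History of the line

* v1 (planner, sha 7022c8cc): white end A + lattice window B + smooth window C, cut at `s = Mδ`.
* lead c1: A LANDED (p143937); hardness certificates (p144970); v2: B cut at the scale where
  provability ends — white window B1 LANDED (`stub_whiteWindow`, p146402); B2, C open.
* lead c2, v3/v3.1: uniform RSW for the `σ`-family isolated as five stubs and LANDED with its glue
  (p156934 p156961 p157141 p157170 p157930 p158228); window hardness + scaling (p158451).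
* lead c3, v3.2 (sha of `work/DriftBound_v32.lean`): `U →` prefixes dropped (U is a theorem),
  B2 ∧ C merged into ONE def-free open stub, the uniform Cauchy window W (`stub_window`;
  `window_of_windows` certifies B2 ∧ C ⇒ W).
* **v4 (this file, lead c3; v4.1 after waves 2–3: S0–S3 LANDED, one sorry left = S4): the DERIVATIVE FORM of W.** The line's mechanism (BMR2020 Lemma 2.22 /
  Thm 2.14 on the lattice) is made the skeleton: the flow is regularised by an independent noise of
  size `η` on each edge and variance-normalised (`regFlow`, defs file
  `Theorems/CardyWhiteToColouredDriftBoundPlackettDefs.lean`, p161596), its exact `σ`-derivative is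
  the Plackett/Piterbarg pair functional `plackettDrift` — PROVABLE, from the generic identity
  already landed by lead c3 (`pl_stein_infinitePi` p161279, `pl_envelope` p161705,
  `pl_hasDerivAt_integral_linGauss` p162138, `pl_integral_fderiv_linGauss` p162707,
  `pl_gaussWeight_family` p163045) — and W follows by the fundamental theorem of calculus in `σ`,
  the limit `η → 0⁺`, and ONE open estimate on the pair functional. Stubs:
  - `stub_locality` (S0, provable): the `η = 0` event of the normalised field on the inner edges IS
    the crux's lattice term: `P_ξ({e ∈ I_δ | X̃^σ_e > 0} ∈ A_δ) = P^latt_{σδ,δ}(R)` (scaling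
    `signConfig_scale`, positivity of the normalisation, locality of `discreteCrossing` on the inner
    edges, finiteness of `innerEdges` for bounded `R`);
  - `stub_driftIdentity` (S1, provable): `HasDerivAt (regFlow I A η) (plackettDrift I A η σ) σ`
    for `η > 0`, `σ > 0` — the exact drift identity;
  - `stub_driftContinuous` (S2, provable): `σ ↦ plackettDrift I A η σ` is continuous on `(0, ∞)`;
  - `stub_regLimit` (S3, provable): `regFlow I A η σ → P_ξ({e ∈ I | X̃^σ_e > 0} ∈ A)` as `η → 0⁺`
    (no atom of `X̃^σ_e` at `0`);
  - `stub_pairEstimate` (S4, OPEN-PROBLEM — the heart, the planner's `PairAsymmetryRate`): the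
    integrated pair functional `∫_{σ₁}^{σ₂} plackettDrift I_δ A_δ η σ dσ` is eventually (as
    `η → 0⁺`) smaller than `ε`, uniformly over `1/(1+|log δ|) ≤ σ₁ ≤ σ₂ ≤ ℓ₀/δ` and `δ < δ₀`
    (first order of the pair functional killed by quarter-turn∘duality; subleading IIC pair-pivotal
    rate `θ > 3/4`; rigorously only `θ > 0`).
  Glue (sorry-free): `window_of_plackett : S0 → S1 → S2 → S3 → S4 → W` (FTC
  `intervalIntegral.integral_eq_sub_of_hasDerivAt`, limit along `𝓝[>] 0`, `le_of_tendsto`), then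
  `DriftBound_of_window B1 W` (v3.2 assembly, kept verbatim).

Disproof used: none on file (`ledger crux ls`, 2026-08-17T13:30Z: no `Disproof.lean`, no dead line,
no crux idea). Numerical kill test of the crux (route "cheapest falsifier", never run before):
kit-compute jobs j025996 / j025997 of lead c3 (queued at registration time), results to the item.
References: BeliaevMuirheadRivera2020 (arXiv:1811.08169 Lemma 2.22 / Thm 2.14), Plackett1954,
GarbanPeteSchramm2013, KestenScalingCMP1987, MuirheadVanneuville2020 §2.1, KohlerSchindlerTassion2023.
-/

noncomputable section

namespace Summit.CriticalPhenomena.CardyFormulaZ2.Cruxes.DriftBound.Birth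

open Set Filter Topology MeasureTheory
open Literature.Probability.LatticeModels Literature.Probability.Percolation
open Literature.Probability.RandomPlanarGeometry

/-! ## The stubs -/

/-! ### S0–S3: LANDED (lead c3, waves 2–3)

The four provable stubs of v4 are tree theorems, imported above and fed by name to the glue:
`stub_locality` (`Theorems/CardyWhiteToColouredDriftBoundStubLocality.lean`, p163713),
`stub_driftIdentity` (`…StubDriftIdentity.lean`, p165365 — the exact Plackett/Piterbarg drift
identity `HasDerivAt (regFlow I A η) (plackettDrift I A η σ) σ`, assembled from the generic pieces
`pl_stein_infinitePi` p161279, `pl_envelope` p161705, `pl_hasDerivAt_integral_linGauss` p162138,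
`pl_integral_fderiv_linGauss` p162707, `pl_gaussWeight_family` p163045, `pl_noiseVar_pos` p163482,
`pl_normWeight_family` p163939, `pl_regIndicator_smooth` p164214), `stub_driftContinuous`
(`…StubDriftContinuous.lean`, p165326), `stub_regLimit` (`…StubRegLimit.lean`, p164093).
Only `stub_pairEstimate` (S4, the open pair estimate) remains. -/

/-- **Stub S4 — the pair estimate (OPEN-PROBLEM: the heart of the crux; planner's
`PairAsymmetryRate`).** For every conformal rectangle `R` and `ε > 0` there are `ℓ₀ > 0` and
`δ₀ > 0` such that for every mesh `δ < δ₀` and all widths `1/(1+|log δ|) ≤ σ₁ ≤ σ₂ ≤ ℓ₀/δ`, the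
integrated Plackett/Piterbarg pair functional of the crossing event of `R_δ` on its inner edges,
`∫_{σ₁}^{σ₂} plackettDrift I_δ A_δ η σ dσ`, is eventually (as the regularisation `η → 0⁺`) less
than `ε` in absolute value. Mechanism (not proved anywhere): per log-scale of `σ` the pair
functional is (pivotal-pair mass `≍ (diam R/(σδ))^{3/4}`) × (series − parallel imbalance), the
first order cancels exactly by the quarter-turn∘duality symmetry of `ℤ²` acting on the medial set
with the ROUND kernel, and the subleading IIC ratio-limit rate `(σδ/diam R)^θ` with `θ > 3/4`
(CFT guess `θ = ω ≈ 3/2`; rigorously only `θ > 0`) makes the drift summable over scales; uniform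
RSW for the `σ`-family (landed, `uniformRSW_signConfigLaw`) supplies the a-priori arm bounds.
With S0–S3 this stub is EQUIVALENT to the uniform Cauchy window W of v3.2 (`window_of_plackett` and
the fundamental theorem of calculus backwards), hence crux-sized: it implies two-model lattice
universality and the continuum crossing limit of smoothed white noise (certificates p158451). -/
theorem stub_pairEstimate :
    ∀ R : Literature.Probability.RandomPlanarGeometry.ConformalRectangle, ∀ ε : ℝ, 0 < ε →
      ∃ ℓ₀ : ℝ, 0 < ℓ₀ ∧ ∃ δ₀ : ℝ, 0 < δ₀ ∧ ∀ δ : ℝ, 0 < δ → δ < δ₀ →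
        ∀ σ₁ σ₂ : ℝ, 1 / (1 + |Real.log δ|) ≤ σ₁ → σ₁ ≤ σ₂ → σ₂ * δ ≤ ℓ₀ →
          ∀ᶠ η : ℝ in nhdsWithin 0 (Set.Ioi 0),
            |∫ s in σ₁..σ₂, plackettDrift (innerEdges R.carrier δ)
                (Literature.Probability.Percolation.discreteCrossing R.carrier δ (R.arc 0) (R.arc 2)) η s| < ε := by
  sorry

/-! ## Glue: the uniform Cauchy window W from S0–S4 -/

/-- **The derivative form gives the window.** From locality/scaling (S0), the exact drift
identity (S1), continuity of the drift (S2), the regularisation limit (S3) and the pair estimate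
(S4): for `δ < δ₀` and `δ/(1+|log δ|) ≤ s₁ ≤ s₂ ≤ ℓ₀`, with `σ_k = s_k/δ`,
`regFlow η σ₂ − regFlow η σ₁ = ∫_{σ₁}^{σ₂} plackettDrift η` (FTC) is eventually `< ε/2`, and
letting `η → 0⁺` gives `|P(s₂) − P(s₁)| ≤ ε/2 < ε`. -/
theorem window_of_plackett
    (hS0 : ∀ R : Literature.Probability.RandomPlanarGeometry.ConformalRectangle, ∀ δ : ℝ, 0 < δ → ∀ σ : ℝ, 0 < σ →
      Literature.Probability.Percolation.latticeWhiteNoise.real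
          {ξ | {e : Sym2 (Literature.Probability.LatticeModels.Site 2) |
            e ∈ innerEdges R.carrier δ ∧ 0 < normNoise σ ξ (Literature.Probability.LatticeModels.medialPoint 1 e)} ∈
            Literature.Probability.Percolation.discreteCrossing R.carrier δ (R.arc 0) (R.arc 2)} =
        Literature.Probability.Percolation.smoothedCrossingProb (σ * δ) δ R.carrier (R.arc 0) (R.arc 2))
    (hS1 : ∀ (I : Finset (Sym2 (Literature.Probability.LatticeModels.Site 2)))
      (A : Set (Set (Sym2 (Literature.Probability.LatticeModels.Site 2)))) (η σ : ℝ), 0 < η → 0 < σ →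
      HasDerivAt (fun s : ℝ => regFlow I A η s) (plackettDrift I A η σ) σ)
    (hS2 : ∀ (I : Finset (Sym2 (Literature.Probability.LatticeModels.Site 2)))
      (A : Set (Set (Sym2 (Literature.Probability.LatticeModels.Site 2)))) (η : ℝ), 0 < η →
      ContinuousOn (fun s : ℝ => plackettDrift I A η s) (Set.Ioi 0))
    (hS3 : ∀ (I : Finset (Sym2 (Literature.Probability.LatticeModels.Site 2)))
      (A : Set (Set (Sym2 (Literature.Probability.LatticeModels.Site 2)))) (σ : ℝ), 0 < σ →
      Filter.Tendsto (fun η : ℝ => regFlow I A η σ) (nhdsWithin 0 (Set.Ioi 0))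
        (nhds (Literature.Probability.Percolation.latticeWhiteNoise.real
          {ξ | {e : Sym2 (Literature.Probability.LatticeModels.Site 2) |
            e ∈ I ∧ 0 < normNoise σ ξ (Literature.Probability.LatticeModels.medialPoint 1 e)} ∈ A})))
    (hS4 : ∀ R : Literature.Probability.RandomPlanarGeometry.ConformalRectangle, ∀ ε : ℝ, 0 < ε →
      ∃ ℓ₀ : ℝ, 0 < ℓ₀ ∧ ∃ δ₀ : ℝ, 0 < δ₀ ∧ ∀ δ : ℝ, 0 < δ → δ < δ₀ →
        ∀ σ₁ σ₂ : ℝ, 1 / (1 + |Real.log δ|) ≤ σ₁ → σ₁ ≤ σ₂ → σ₂ * δ ≤ ℓ₀ →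
          ∀ᶠ η : ℝ in nhdsWithin 0 (Set.Ioi 0),
            |∫ s in σ₁..σ₂, plackettDrift (innerEdges R.carrier δ)
                (Literature.Probability.Percolation.discreteCrossing R.carrier δ (R.arc 0) (R.arc 2)) η s| < ε) :
    ∀ R : Literature.Probability.RandomPlanarGeometry.ConformalRectangle, ∀ ε : ℝ, 0 < ε →
      ∃ ℓ₀ : ℝ, 0 < ℓ₀ ∧ ∃ δ₀ : ℝ, 0 < δ₀ ∧ ∀ δ : ℝ, 0 < δ → δ < δ₀ →
        ∀ s₁ s₂ : ℝ, δ / (1 + |Real.log δ|) ≤ s₁ → s₁ ≤ s₂ → s₂ ≤ ℓ₀ →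
          |Literature.Probability.Percolation.smoothedCrossingProb s₂ δ R.carrier (R.arc 0) (R.arc 2)
            - Literature.Probability.Percolation.smoothedCrossingProb s₁ δ R.carrier (R.arc 0) (R.arc 2)| < ε := by
  intro R ε hε
  have hε2 : (0 : ℝ) < ε / 2 := by positivity
  obtain ⟨ℓ₀, hℓ₀, δ₀, hδ₀, H⟩ := hS4 R (ε / 2) hε2
  refine ⟨ℓ₀, hℓ₀, δ₀, hδ₀, fun δ hδ hδlt s₁ s₂ hs₁ hs₁₂ hs₂ => ?_⟩
  -- the inner edges and the crossing event at mesh `δ`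
  set I : Finset (Sym2 (Site 2)) := innerEdges R.carrier δ with hI
  set A : Set (Set (Sym2 (Site 2))) := discreteCrossing R.carrier δ (R.arc 0) (R.arc 2) with hA
  -- widths in lattice units
  set σ₁ : ℝ := s₁ / δ with hσ₁
  set σ₂ : ℝ := s₂ / δ with hσ₂
  have hlog : (0 : ℝ) < 1 + |Real.log δ| := by positivity
  have hcut : 0 < δ / (1 + |Real.log δ|) := div_pos hδ hlog
  have hs₁pos : 0 < s₁ := hcut.trans_le hs₁
  have hσ₁pos : 0 < σ₁ := div_pos hs₁pos hδ
  have hσ₁le : 1 / (1 + |Real.log δ|) ≤ σ₁ := by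
    rw [hσ₁, le_div_iff₀ hδ, div_mul_eq_mul_div, one_mul]
    exact hs₁
  have hσ₁₂ : σ₁ ≤ σ₂ := div_le_div_of_nonneg_right hs₁₂ hδ.le
  have hσ₂ℓ : σ₂ * δ ≤ ℓ₀ := by
    rw [hσ₂, div_mul_cancel₀ s₂ hδ.ne']
    exact hs₂
  have hσpos : ∀ σ ∈ uIcc σ₁ σ₂, 0 < σ := by
    intro σ hσ
    rw [uIcc_of_le hσ₁₂] at hσ
    exact hσ₁pos.trans_le hσ.1
  -- (S4) the integrated pair functional is eventually small
  have hev := H δ hδ hδlt σ₁ σ₂ hσ₁le hσ₁₂ hσ₂ℓ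
  -- (S1)+(S2): FTC, `regFlow η σ₂ − regFlow η σ₁ = ∫ plackettDrift η`
  have hftc : ∀ η : ℝ, 0 < η →
      ∫ s in σ₁..σ₂, plackettDrift I A η s = regFlow I A η σ₂ - regFlow I A η σ₁ := by
    intro η hη
    refine intervalIntegral.integral_eq_sub_of_hasDerivAt (fun σ hσ => hS1 I A η σ hη (hσpos σ hσ)) ?_
    refine ContinuousOn.intervalIntegrable ?_
    exact (hS2 I A η hη).mono fun σ hσ => hσpos σ hσ
  have hev' : ∀ᶠ η : ℝ in 𝓝[>] 0, |regFlow I A η σ₂ - regFlow I A η σ₁| ≤ ε / 2 := by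
    filter_upwards [hev, self_mem_nhdsWithin] with η h hηpos
    rw [← hftc η hηpos]
    exact h.le
  -- (S3) let `η → 0⁺`
  set L : ℝ → ℝ := fun σ => latticeWhiteNoise.real
    {ξ | {e : Sym2 (Site 2) | e ∈ I ∧ 0 < normNoise σ ξ (medialPoint 1 e)} ∈ A} with hL
  have hlim : Tendsto (fun η : ℝ => |regFlow I A η σ₂ - regFlow I A η σ₁|) (𝓝[>] 0)
      (𝓝 |L σ₂ - L σ₁|) :=
    ((hS3 I A σ₂ (hσ₁pos.trans_le hσ₁₂)).sub (hS3 I A σ₁ hσ₁pos)).abs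
  have hle : |L σ₂ - L σ₁| ≤ ε / 2 := le_of_tendsto hlim hev'
  -- (S0) the limits are the crux's lattice terms
  have h₁ : L σ₁ = smoothedCrossingProb s₁ δ R.carrier (R.arc 0) (R.arc 2) := by
    have := hS0 R δ hδ σ₁ hσ₁pos
    rw [hσ₁, div_mul_cancel₀ s₁ hδ.ne'] at this
    exact this
  have h₂ : L σ₂ = smoothedCrossingProb s₂ δ R.carrier (R.arc 0) (R.arc 2) := by
    have := hS0 R δ hδ σ₂ (hσ₁pos.trans_le hσ₁₂)
    rw [hσ₂, div_mul_cancel₀ s₂ hδ.ne'] at this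
    exact this
  rw [← h₁, ← h₂]
  exact hle.trans_lt (half_lt_self hε)

/-! ## Assembly (v3.2, unchanged) -/

/-- The cut scale `s⋆ = δ/(1 + |log δ|)` of the white window is positive and at most `δ`. -/
theorem cutScale_pos_le {δ : ℝ} (hδ : 0 < δ) :
    0 < δ / (1 + |Real.log δ|) ∧ δ / (1 + |Real.log δ|) ≤ δ := by
  have h1 : (1 : ℝ) ≤ 1 + |Real.log δ| := le_add_of_nonneg_right (abs_nonneg _)
  have hpos : (0 : ℝ) < 1 + |Real.log δ| := one_pos.trans_le h1
  exact ⟨div_pos hδ hpos, div_le_self hδ.le h1⟩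

/-- **Assembly of the line (v3.2, verbatim)**: the white window B1 and the uniform Cauchy window W
give the crux `DriftBound`. -/
theorem DriftBound_of_window
    (hB1 : ∀ R : Literature.Probability.RandomPlanarGeometry.ConformalRectangle, ∀ ε : ℝ, 0 < ε →
      ∃ δ₀ : ℝ, 0 < δ₀ ∧ ∀ δ : ℝ, 0 < δ → δ < δ₀ → ∀ s : ℝ, 0 < s → s ≤ δ / (1 + |Real.log δ|) →
        |Literature.Probability.Percolation.smoothedCrossingProb s δ R.carrier (R.arc 0) (R.arc 2)
          - Literature.Probability.Percolation.bondDomainCrossingProb R δ| < ε)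
    (hW : ∀ R : Literature.Probability.RandomPlanarGeometry.ConformalRectangle, ∀ ε : ℝ, 0 < ε →
      ∃ ℓ₀ : ℝ, 0 < ℓ₀ ∧ ∃ δ₀ : ℝ, 0 < δ₀ ∧ ∀ δ : ℝ, 0 < δ → δ < δ₀ →
        ∀ s₁ s₂ : ℝ, δ / (1 + |Real.log δ|) ≤ s₁ → s₁ ≤ s₂ → s₂ ≤ ℓ₀ →
          |Literature.Probability.Percolation.smoothedCrossingProb s₂ δ R.carrier (R.arc 0) (R.arc 2)
            - Literature.Probability.Percolation.smoothedCrossingProb s₁ δ R.carrier (R.arc 0) (R.arc 2)| < ε) :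
    Summit.CriticalPhenomena.CardyFormulaZ2.Theses.CardyWhiteToColoured.DriftBound := by
  intro R ε hε
  have hε2 : (0 : ℝ) < ε / 2 := by positivity
  obtain ⟨ℓ₀, hℓ₀, δ₁, hδ₁, hW⟩ := hW R (ε / 2) hε2
  obtain ⟨δ₂, hδ₂, hB1⟩ := hB1 R (ε / 2) hε2
  refine ⟨ℓ₀, hℓ₀, fun ℓ hℓ hℓℓ₀ => ?_⟩
  refine ⟨min (min δ₁ δ₂) ℓ, lt_min (lt_min hδ₁ hδ₂) hℓ, fun δ hδ hδlt => ?_⟩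
  have hδ₁' : δ < δ₁ := lt_of_lt_of_le hδlt ((min_le_left _ _).trans (min_le_left _ _))
  have hδ₂' : δ < δ₂ := lt_of_lt_of_le hδlt ((min_le_left _ _).trans (min_le_right _ _))
  have hδℓ : δ < ℓ := lt_of_lt_of_le hδlt (min_le_right _ _)
  obtain ⟨hspos, hsle⟩ := cutScale_pos_le hδ
  set s := δ / (1 + |Real.log δ|) with hs
  have hsℓ : s ≤ ℓ := hsle.trans hδℓ.le
  have h2 : |smoothedCrossingProb ℓ δ R.carrier (R.arc 0) (R.arc 2)
      - smoothedCrossingProb s δ R.carrier (R.arc 0) (R.arc 2)| < ε / 2 :=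
    hW δ hδ hδ₁' s ℓ le_rfl hsℓ hℓℓ₀.le
  have h1 : |smoothedCrossingProb s δ R.carrier (R.arc 0) (R.arc 2)
      - bondDomainCrossingProb R δ| < ε / 2 :=
    hB1 δ hδ hδ₂' s hspos le_rfl
  have h : |bondDomainCrossingProb R δ
      - smoothedCrossingProb ℓ δ R.carrier (R.arc 0) (R.arc 2)| < ε := by
    have := abs_sub_lt_iff.1 h1
    have := abs_sub_lt_iff.1 h2
    rw [abs_sub_lt_iff]
    constructor <;> linarith
  rw [smoothedCrossingProb_conformalRectangle_eq] at h
  exact h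

/-- **The skeleton as a (conditional) proof of the crux** — the shape audited by
`ledger skeleton check` (no hypotheses, concludes `DriftBound` BY NAME, reaches the crux from the
declared stubs only): the white window B1 is the imported tree theorem `stub_whiteWindow`; the
uniform Cauchy window comes from the five v4 stubs through `window_of_plackett`. It becomes a
closed proof exactly when `stub_locality`, `stub_driftIdentity`, `stub_driftContinuous`,
`stub_regLimit` (provable) and `stub_pairEstimate` (open) are proved. -/
theorem driftBound_of_stubs :
    Summit.CriticalPhenomena.CardyFormulaZ2.Theses.CardyWhiteToColoured.DriftBound :=
  DriftBound_of_window stub_whiteWindow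
    (window_of_plackett stub_locality stub_driftIdentity stub_driftContinuous stub_regLimit
      stub_pairEstimate)

end Summit.CriticalPhenomena.CardyFormulaZ2.Cruxes.DriftBound.Birth

end
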